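import Summits.BirchSwinnertonDyer.BirchSwinnertonDyer.Theorems.AlignedTransportAtTwoMainConjectureOfRankZeroBSDAtTwoFineRoadArchReceptacle
import Summits.BirchSwinnertonDyer.BirchSwinnertonDyer.Theorems.AlignedTransportAtTwoMainConjectureOfRankZeroBSDAtTwoFineRoadArchRigidity
import Summits.BirchSwinnertonDyer.BirchSwinnertonDyer.Theorems.AlignedTransportAtTwoMainConjectureOfRankZeroBSDAtTwoFineRoadArchLocalDichotomy
import Summits.BirchSwinnertonDyer.BirchSwinnertonDyer.Theorems.AlignedTransportAtTwoMainConjectureOfRankZeroBSDAtTwoFineRoadCyclicLength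
import HarnessLib

/-!
# Road (b″) of crux C2 `MainConjectureOfRankZeroBSDAtTwo` (stmt-BirchSwinnertonDyer-22298), line `birth`:
# THE ARCHIMEDEAN `μ`-DEFECT IS AT MOST ONE — `ℓ₍₂₎(ker(X^{rel ∞} ↠ X)) ≤ 1`, i.e. `μ₂(X^{rel ∞}(E/ℚ_∞)) ≤ μ₂(X(E/ℚ_∞)) + 1`,
# unconditionally; with Greenberg's Lemma 4.6 at `2`: `= μ₂(X) + [Δ_E > 0]`

HONEST FRAMING (cell `bsd-f1-sign2`, attach seat `bsd-line-att-p4` g5, route `AlignedTransportAtTwo`; BSD is NOT proved by any of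
this; the crux C2 stays OPEN). THEOREMS ONLY; `--supports stmt-BirchSwinnertonDyer-22298`, C2-NEUTRAL.

WHAT. Greenberg, LNM 1716 §4 Remark after Lemma 4.6 (PDF p. 106): at `p = 2` the archimedean factor of the Selmer group of `ℚ_∞` is
`𝒫_E^{(∞)}(ℚ_∞) ≅ Hom(Λ/2Λ, ℤ/2)` when `E[2] ⊂ E(ℝ)` («usually this group is zero»). The tree has its LOWER half as the PRINT fact
p608868 (`lemma46_relaxed_mod_selmer_infinite_rat_two`: `Sel^{rel ∞}/Sel` infinite for `Δ_E > 0`). This file PROVES the UPPER half,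
unconditionally, for every elliptic `W/ℚ`: for ANY pinned dual `Xr` of `Sel^{rel ∞}(ℚ_∞, E[2^∞])`, ANY datum `D` of `Sel_{2^∞}(E/ℚ_∞)` and the
archimedean extension `q : Xr ↠ D.X` (`…FineRoadArchReceptacle`),

  **`ℓ₍₂₎(ker q) ≤ 1`** (`lengthAt_ker_archExtension_le_one`), hence **`ℓ₍₂₎(X^{rel ∞}) ≤ ℓ₍₂₎(X) + 1`**
  (`lengthAt_relaxed_le_lengthAt_selmer_add_one`) and, GRANTED p608868, `Δ_W > 0 ⇒ ℓ₍₂₎(X^{rel ∞}) = ℓ₍₂₎(X) + 1`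
  (`lengthAt_relaxed_eq_lengthAt_selmer_add_one_of_Δ_pos`).

Proof: `(ker q, Sel^{rel ∞}/Sel, conj_γ − 1)` is an axiomatic Pontryagin dual pair (`IwasawaDual.IsDualPair`, §1 inside the proof); its first
piece `(Sel^{rel ∞}/Sel)^γ` has at most one non-zero class by ARCHIMEDEAN RIGIDITY (`…ArchRigidity`: a `γ`-invariant defect is detected at
the chosen real place) and the LOCAL DICHOTOMY (`…ArchLocalDichotomy`: `#H¹(ℚ_{∞,w}, E[2^∞])|_{image} ≤ 2`); `2·ker q = 0`; so `ker q` is a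
cyclic quotient of `Λ/2Λ` (`…CyclicLength.lengthAt_le_one_of_isDualPair_two`: Pontryagin exactness `(X/𝔪X)^∨ = S[𝔪]` + Nakayama).

References: R. Greenberg, LNM 1716 (1999), §4 Lemma 4.6 and Remark (PDF pp. 105–107); S. Lang, *Cyclotomic Fields I–II*, Ch. 5 §1;
L. Washington, GTM 83, §13.2.
-/

set_option autoImplicit false
-- the Theorems namespace of this sub repeats the summit name by design (D-0017 nested layout)
set_option linter.dupNamespace false

noncomputable section

open scoped Classical

namespace Summit.BirchSwinnertonDyer.BirchSwinnertonDyer.Theorems.AlignedTransportAtTwoFineRoad.ArchKernelLength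

open NumberField IsDedekindDomain Field WeierstrassCurve
open Literature.NumberTheory.EllipticCurves Literature.NumberTheory.EllipticCurves.IwasawaAlgebra
  Literature.NumberTheory.EllipticCurves.Module Literature.NumberTheory.EllipticCurves.Greenberg1999
  Literature.NumberTheory.GaloisRepresentations ZpExtension

variable (W : WeierstrassCurve ℚ) [W.IsElliptic] (κ : ZpExtension ℚ 2) {γ : Field.absoluteGaloisGroup ℚ}
  {Xr : Type*} [AddCommGroup Xr] [_root_.Module (IwasawaAlgebra 2) Xr]
  (toDualR : Xr →+ (relaxedSelmerInftyAtTwo W κ →+ AddCircle (1 : ℚ)))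

/-- **`(Sel^{rel ∞}/Sel)^γ` has at most one non-zero class.** For `γ` a topological generator and `c, c' ∈ Sel^{rel ∞}(ℚ_∞, E[2^∞])` whose
`γ`-defects `conj_γ c − c`, `conj_γ c' − c'` lie in `Sel_{2^∞}(E/ℚ_∞)`: `c ∈ Sel ∨ c' ∈ Sel ∨ c − c' ∈ Sel` — archimedean rigidity
(`ArchRigidity.mem_selmerInfty_of_relaxed_of_defect_of_localKer_inf`: such classes are Selmer iff they satisfy the archimedean condition at the
chosen real place) + the local dichotomy (`ArchLocalDichotomy.sub_mem_localKerOver_inf_or`). [cite: GreenbergLNM1716, §4 Remark after Lemma 4.6 (PDF p. 106)] -/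
theorem mem_selmerInfty_or_of_defects (hγ : κ.IsTopGenerator γ) {c c' : W.subgroupH1 2 κ.kerSubgroup}
    (hc : c ∈ relaxedSelmerInftyAtTwo W κ) (hc' : c' ∈ relaxedSelmerInftyAtTwo W κ)
    (hdef : W.conjH1 2 κ.kerSubgroup γ c - c ∈ W.selmerInfty κ) (hdef' : W.conjH1 2 κ.kerSubgroup γ c' - c' ∈ W.selmerInfty κ) :
    c ∈ W.selmerInfty κ ∨ c' ∈ W.selmerInfty κ ∨ c - c' ∈ W.selmerInfty κ := by
  obtain ⟨w₀⟩ := (inferInstance : Nonempty (InfinitePlace ℚ))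
  have hall : ∀ {d : W.subgroupH1 2 κ.kerSubgroup}, d ∈ W.localKerOver 2 κ.kerSubgroup w₀.Completion →
      ∀ w : InfinitePlace ℚ, d ∈ W.localKerOver 2 κ.kerSubgroup w.Completion := by
    intro d hd w
    rw [Subsingleton.elim w w₀]
    exact hd
  rcases ArchLocalDichotomy.sub_mem_localKerOver_inf_or W κ.kerSubgroup w₀ c c' with h | h | h
  · exact Or.inl (ArchRigidity.mem_selmerInfty_of_relaxed_of_defect_of_localKer_inf W κ hγ hc hdef (hall h))
  · exact Or.inr (Or.inl (ArchRigidity.mem_selmerInfty_of_relaxed_of_defect_of_localKer_inf W κ hγ hc' hdef' (hall h)))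
  · exact Or.inr (Or.inr (ArchRigidity.sub_mem_selmerInfty_of_relaxed_of_defect W κ hγ hc hc' hdef hdef' (hall h)))

/-- **THE ARCHIMEDEAN `μ`-DEFECT IS AT MOST ONE: `ℓ₍₂₎(ker q) ≤ 1`.** For `W/ℚ` elliptic, `γ` a topological generator of the
`ℤ₂`-extension `κ`, ANY `Λ`-module `Xr` pinned to `Sel^{rel ∞}(ℚ_∞, E[2^∞])` (additive bijection `toDualR` + the two compatibilities), ANY
Pontryagin-dual datum `D` of `Sel_{2^∞}(E/ℚ_∞)` and ANY compatible `Λ`-linear `q : Xr → D.X` (the archimedean extension, onto): the `(2)`-length of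
`ker q = (Sel^{rel ∞}/Sel)^∨` is at most `1`. Unconditional; no reduction hypothesis. Proof: `(ker q, Sel^{rel ∞}/Sel, conj_γ − 1)` is an
`IwasawaDual.IsDualPair` whose first piece has at most one non-zero class (`mem_selmerInfty_or_of_defects`) and `2·ker q = 0`, so
`CyclicLength.lengthAt_le_one_of_isDualPair_two` applies. [cite: GreenbergLNM1716, §4 Lemma 4.6 and Remark (PDF pp. 105–107)]
[cite: Lang1990, Ch. 5 §1 (Nakayama's lemma)] -/
theorem lengthAt_ker_archExtension_le_one (hγ : κ.IsTopGenerator γ) (hR : Function.Bijective toDualR)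
    (hT : ∀ (x : Xr) (s : relaxedSelmerInftyAtTwo W κ),
      toDualR ((PowerSeries.X : IwasawaAlgebra 2) • x) s =
        toDualR x ⟨W.conjH1 2 κ.kerSubgroup γ s, ArchReceptacle.conjH1_mem_relaxedSelmerInftyAtTwo W κ γ s.2⟩ - toDualR x s)
    (hC : ∀ (c : ℤ_[2]) (x : Xr) (s : relaxedSelmerInftyAtTwo W κ) (k : ℕ), (2 ^ k) • s = 0 →
      toDualR (PowerSeries.C c • x) s = (PadicInt.toZModPow k c).val • toDualR x s)
    (D : W.SelmerDualData κ γ) (q : Xr →ₗ[IwasawaAlgebra 2] D.X)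
    (hq : ∀ (x : Xr) (s : W.selmerInfty κ),
      D.toDual (q x) s = toDualR x (AddSubgroup.inclusion (selmerInfty_le_relaxedSelmerInftyAtTwo W κ) s)) :
    lengthAt (IwasawaAlgebra 2) (LinearMap.ker q) ⟨augIdealP 2, isPrime_augIdealP_holds 2⟩ ≤ 1 := by
  -- finite generation of `ker q`
  haveI : Module.Finite (IwasawaAlgebra 2) Xr := ArchReceptacle.module_finite_of_pinned W κ hγ toDualR hR hT hC
  haveI : IsNoetherian (IwasawaAlgebra 2) Xr := isNoetherian_of_isNoetherianRing_of_finite _ _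
  haveI : Module.Finite (IwasawaAlgebra 2) (LinearMap.ker q) :=
    Module.Finite.iff_fg.mpr (IsNoetherian.noetherian _)
  -- notation: `SelR = Sel` inside `R = Sel^{rel ∞}`
  let SelR : AddSubgroup (relaxedSelmerInftyAtTwo W κ) := (W.selmerInfty κ).addSubgroupOf (relaxedSelmerInftyAtTwo W κ)
  -- `conj_γ` on `R`, and `Sel` is stable
  let φR : AddMonoid.End (relaxedSelmerInftyAtTwo W κ) :=
    AddMonoidHom.mk' (fun c ↦ ⟨W.conjH1 2 κ.kerSubgroup γ c, ArchReceptacle.conjH1_mem_relaxedSelmerInftyAtTwo W κ γ c.2⟩)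
      (fun a b ↦ Subtype.ext (by
        change W.conjH1 2 κ.kerSubgroup γ ((a : W.subgroupH1 2 κ.kerSubgroup) + b) =
          W.conjH1 2 κ.kerSubgroup γ a + W.conjH1 2 κ.kerSubgroup γ b
        exact map_add _ _ _))
  have hφR : ∀ s : relaxedSelmerInftyAtTwo W κ,
      ((φR s : relaxedSelmerInftyAtTwo W κ) : W.subgroupH1 2 κ.kerSubgroup) = W.conjH1 2 κ.kerSubgroup γ s := fun _ ↦ rfl
  have hSel : ∀ s ∈ W.selmerInfty κ, W.conjH1 2 κ.kerSubgroup γ s ∈ W.selmerInfty κ := fun s hs ↦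
    W.map_conjH1_selmerGroupOver_le_holds 2 κ.kerSubgroup γ ⟨s, hs, rfl⟩
  have hφSel : SelR ≤ SelR.comap (φR : relaxedSelmerInftyAtTwo W κ →+ relaxedSelmerInftyAtTwo W κ) := fun s hs ↦ by
    change ((φR s : relaxedSelmerInftyAtTwo W κ) : W.subgroupH1 2 κ.kerSubgroup) ∈ W.selmerInfty κ
    rw [hφR]
    exact hSel _ hs
  -- the endomorphism `ψ' = conj_γ − 1` of `R/Sel`
  let ψ' : AddMonoid.End (relaxedSelmerInftyAtTwo W κ ⧸ SelR) :=
    (show AddMonoid.End (relaxedSelmerInftyAtTwo W κ ⧸ SelR) from QuotientAddGroup.map SelR SelR φR hφSel) - 1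
  have hψ' : ∀ s : relaxedSelmerInftyAtTwo W κ, ψ' (QuotientAddGroup.mk s) = QuotientAddGroup.mk (φR s - s) := by
    intro s
    change QuotientAddGroup.map SelR SelR φR hφSel (QuotientAddGroup.mk s) - QuotientAddGroup.mk s = _
    rw [QuotientAddGroup.map_mk, QuotientAddGroup.mk_sub]
    rfl
  have hψ'pow : ∀ (n : ℕ) (s : relaxedSelmerInftyAtTwo W κ),
      (ψ' ^ n) (QuotientAddGroup.mk s) = QuotientAddGroup.mk (((φR - 1) ^ n) s) := by
    intro n
    induction n with
    | zero => intro s; rfl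
    | succ n ih =>
      intro s
      rw [pow_succ, AddMonoid.End.coe_mul, Function.comp_apply, hψ', ih, pow_succ, AddMonoid.End.coe_mul,
        Function.comp_apply]
      rfl
  -- every `x ∈ ker q` kills `Sel`
  have hkill : ∀ x : LinearMap.ker q, SelR ≤ (toDualR (x : Xr)).ker := by
    intro x s hs
    rw [AddMonoidHom.mem_ker]
    have h := (ArchKernel.apply_eq_zero_iff (selmerInfty_le_relaxedSelmerInftyAtTwo W κ) D.toDual toDualR
      q.toAddMonoidHom D.bijective hq (x : Xr)).mp x.2 ⟨(s : W.subgroupH1 2 κ.kerSubgroup), hs⟩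
    have e : AddSubgroup.inclusion (selmerInfty_le_relaxedSelmerInftyAtTwo W κ)
        ⟨(s : W.subgroupH1 2 κ.kerSubgroup), hs⟩ = s := Subtype.ext rfl
    rwa [e] at h
  -- the pinning `toDual' : ker q → Hom(R/Sel, ℚ/ℤ)`
  let toDual' : LinearMap.ker q →+ (relaxedSelmerInftyAtTwo W κ ⧸ SelR →+ AddCircle (1 : ℚ)) :=
    AddMonoidHom.mk' (fun x ↦ QuotientAddGroup.lift SelR (toDualR (x : Xr)) (hkill x)) (fun x y ↦ by
      refine AddMonoidHom.ext fun s' ↦ QuotientAddGroup.induction_on s' fun s ↦ ?_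
      rw [AddMonoidHom.add_apply, QuotientAddGroup.lift_mk, QuotientAddGroup.lift_mk, QuotientAddGroup.lift_mk,
        Submodule.coe_add, map_add, AddMonoidHom.add_apply])
  have htoDual' : ∀ (x : LinearMap.ker q) (s : relaxedSelmerInftyAtTwo W κ),
      toDual' x (QuotientAddGroup.mk s) = toDualR (x : Xr) s := fun x s ↦ rfl
  -- the dual pair
  have hpair : IwasawaDual.IsDualPair 2 ψ' toDual' :=
    { bijective := by
        constructor
        · intro x y hxy
          apply Subtype.ext
          apply hR.1
          ext s
          rw [← htoDual', ← htoDual', hxy]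
        · intro χ
          obtain ⟨x, hx⟩ := hR.2 (χ.comp (QuotientAddGroup.mk' SelR))
          have hxker : (x : Xr) ∈ LinearMap.ker q := by
            rw [LinearMap.mem_ker]
            refine (ArchKernel.apply_eq_zero_iff (selmerInfty_le_relaxedSelmerInftyAtTwo W κ) D.toDual toDualR
              q.toAddMonoidHom D.bijective hq x).mpr fun s ↦ ?_
            rw [hx, AddMonoidHom.comp_apply, QuotientAddGroup.mk'_apply,
              (QuotientAddGroup.eq_zero_iff _).mpr (show _ ∈ SelR from s.2), map_zero]
          refine ⟨⟨x, hxker⟩, AddMonoidHom.ext fun s' ↦ QuotientAddGroup.induction_on s' fun s ↦ ?_⟩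
          rw [htoDual', hx, AddMonoidHom.comp_apply, QuotientAddGroup.mk'_apply]
      T_smul := by
        intro x s'
        induction s' using QuotientAddGroup.induction_on with
        | H s =>
          rw [hψ', htoDual', htoDual', Submodule.coe_smul, hT, map_sub]
          rfl
      C_smul := by
        intro c x s' k hk
        induction s' using QuotientAddGroup.induction_on with
        | H s =>
          rw [htoDual', htoDual', Submodule.coe_smul]
          -- `2^k s ∈ Sel`, so `2^k · toDualR x s = 0`
          have hks : (2 ^ k) • s ∈ SelR := by
            rw [← QuotientAddGroup.eq_zero_iff, QuotientAddGroup.mk_nsmul]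
            exact hk
          have hval : (2 ^ k) • toDualR (x : Xr) s = 0 := by
            rw [← map_nsmul]
            exact hkill x hks
          -- a level `j + k` killing `s`
          obtain ⟨j, hj⟩ := W.exists_pow_smul_subgroupH1_ker_eq_zero κ (s : W.subgroupH1 2 κ.kerSubgroup)
          have hjk : (2 ^ (j + k)) • s = 0 := by
            apply Subtype.ext
            rw [AddSubgroupClass.coe_nsmul, pow_add, mul_comm, mul_smul, hj, smul_zero, ZeroMemClass.coe_zero]
          rw [hC c (x : Xr) s (j + k) hjk, ← IwasawaDual.zpT_def, ← IwasawaDual.zpT_def,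
            IwasawaDual.zpT_of_le (Nat.le_add_left k j) hval]
      locNil := by
        have hloc := W.isLocNil_sub_one_of_coe_eq_conjH1 κ hγ (relaxedSelmerInftyAtTwo W κ) φR hφR
        refine ⟨fun s' ↦ ?_, fun s' ↦ ?_⟩
        · induction s' using QuotientAddGroup.induction_on with
          | H s =>
            obtain ⟨k, hk⟩ := hloc.torsion s
            exact ⟨k, by rw [← QuotientAddGroup.mk_nsmul, hk, QuotientAddGroup.mk_zero]⟩
        · induction s' using QuotientAddGroup.induction_on with
          | H s =>
            obtain ⟨N, hN⟩ := hloc.nil s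
            exact ⟨N, by rw [hψ'pow, hN, QuotientAddGroup.mk_zero]⟩ }
  -- the first piece of `(R/Sel, ψ')` has at most one non-zero class
  have hpiece_mem : ∀ s : relaxedSelmerInftyAtTwo W κ, QuotientAddGroup.mk s ∈ IwasawaDual.piece 2 ψ' 1 →
      W.conjH1 2 κ.kerSubgroup γ (s : W.subgroupH1 2 κ.kerSubgroup) - s ∈ W.selmerInfty κ := by
    intro s hs
    have h2 := (IwasawaDual.mem_piece.mp hs).2
    rw [pow_one, hψ', QuotientAddGroup.eq_zero_iff] at h2
    exact h2
  have hpiece : ∃ s₀ : relaxedSelmerInftyAtTwo W κ ⧸ SelR, ∀ s' ∈ IwasawaDual.piece 2 ψ' 1, s' = 0 ∨ s' = s₀ := by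
    by_cases hex : ∃ s : relaxedSelmerInftyAtTwo W κ, W.conjH1 2 κ.kerSubgroup γ (s : W.subgroupH1 2 κ.kerSubgroup) - s ∈ W.selmerInfty κ ∧
        (s : W.subgroupH1 2 κ.kerSubgroup) ∉ W.selmerInfty κ
    · obtain ⟨s₀, hs₀def, hs₀⟩ := hex
      refine ⟨QuotientAddGroup.mk s₀, fun s' hs' ↦ ?_⟩
      induction s' using QuotientAddGroup.induction_on with
      | H s =>
        rcases mem_selmerInfty_or_of_defects W κ hγ s.2 s₀.2 (hpiece_mem s hs') hs₀def with h | h | h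
        · exact Or.inl ((QuotientAddGroup.eq_zero_iff _).mpr h)
        · exact absurd h hs₀
        · exact Or.inr (QuotientAddGroup.eq_iff_sub_mem.mpr h)
    · refine ⟨0, fun s' hs' ↦ Or.inl ?_⟩
      induction s' using QuotientAddGroup.induction_on with
      | H s =>
        rw [QuotientAddGroup.eq_zero_iff]
        by_contra hs
        exact hex ⟨s, hpiece_mem s hs', hs⟩
  obtain ⟨s₀, hs₀⟩ := hpiece
  -- `2 · ker q = 0`
  have h2 : ∀ x : LinearMap.ker q, (2 : ℕ) • x = 0 := fun x ↦ Subtype.ext (by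
    rw [Submodule.coe_smul_of_tower, Submodule.coe_zero]
    exact ArchReceptacle.two_nsmul_eq_zero_of_archExtension_eq_zero W κ toDualR hR D q.toAddMonoidHom hq x.2)
  exact CyclicLength.lengthAt_le_one_of_isDualPair_two hpair h2 hs₀

/-- **`ℓ₍₂₎(X^{rel ∞}) ≤ ℓ₍₂₎(X) + 1`** for every pinned relaxed dual `Xr` and every datum `D` of `Sel_{2^∞}(E/ℚ_∞)` (via any compatible `q`;
`μ₂(X^{rel ∞}(E/ℚ_∞)) ≤ μ₂(X(E/ℚ_∞)) + 1`): additivity `ℓ₍₂₎(Xr) = ℓ₍₂₎(ker q) + ℓ₍₂₎(D.X)` (`ArchRigidity.lengthAt_relaxed_eq_lengthAt_ker_add`) and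
`ℓ₍₂₎(ker q) ≤ 1`. Unconditional. [cite: GreenbergLNM1716, §4 Remark after Lemma 4.6 (PDF p. 106)] -/
theorem lengthAt_relaxed_le_lengthAt_selmer_add_one (hγ : κ.IsTopGenerator γ) (hR : Function.Bijective toDualR)
    (hT : ∀ (x : Xr) (s : relaxedSelmerInftyAtTwo W κ),
      toDualR ((PowerSeries.X : IwasawaAlgebra 2) • x) s =
        toDualR x ⟨W.conjH1 2 κ.kerSubgroup γ s, ArchReceptacle.conjH1_mem_relaxedSelmerInftyAtTwo W κ γ s.2⟩ - toDualR x s)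
    (hC : ∀ (c : ℤ_[2]) (x : Xr) (s : relaxedSelmerInftyAtTwo W κ) (k : ℕ), (2 ^ k) • s = 0 →
      toDualR (PowerSeries.C c • x) s = (PadicInt.toZModPow k c).val • toDualR x s)
    (D : W.SelmerDualData κ γ) (q : Xr →ₗ[IwasawaAlgebra 2] D.X)
    (hq : ∀ (x : Xr) (s : W.selmerInfty κ),
      D.toDual (q x) s = toDualR x (AddSubgroup.inclusion (selmerInfty_le_relaxedSelmerInftyAtTwo W κ) s)) :
    lengthAt (IwasawaAlgebra 2) Xr ⟨augIdealP 2, isPrime_augIdealP_holds 2⟩ ≤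
      lengthAt (IwasawaAlgebra 2) D.X ⟨augIdealP 2, isPrime_augIdealP_holds 2⟩ + 1 := by
  rw [ArchRigidity.lengthAt_relaxed_eq_lengthAt_ker_add W toDualR hR D q hq, add_comm]
  exact add_le_add le_rfl (lengthAt_ker_archExtension_le_one W κ toDualR hγ hR hT hC D q hq)

/-- **`Δ_W > 0`: `ℓ₍₂₎(X^{rel ∞}) = ℓ₍₂₎(X) + 1` EXACTLY, GRANTED Greenberg's Lemma 4.6 at `2`** (PRINT fact p608868; `W` globally minimal,
good ordinary at `2`, `κ` cyclotomic, `D` torsion): the upper bound of this file with the lower bound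
`ArchRigidity.lengthAt_selmer_add_one_le_lengthAt_relaxed` — Greenberg's `𝒫_∞ ≅ Hom(Λ/2Λ, ℤ/2)` in `μ`-form. (For `Δ_W < 0` the two lengths
are equal unconditionally: `ArchRigidity.lengthAt_relaxed_eq_of_Δ_neg`.) [cite: GreenbergLNM1716, §4 Lemma 4.6 and Remark (PDF pp. 105–107)] -/
theorem lengthAt_relaxed_eq_lengthAt_selmer_add_one_of_Δ_pos (h46 : lemma46_relaxed_mod_selmer_infinite_rat_two) [W.IsGloballyMinimal]
    (hord : IsOrdinaryAt W 2) (hΔ : 0 < W.Δ) (hκ : κ.IsCyclotomic) (hγ : κ.IsTopGenerator γ) (D : W.SelmerDualData κ γ)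
    (hD : D.IsTorsion) (hR : Function.Bijective toDualR)
    (hT : ∀ (x : Xr) (s : relaxedSelmerInftyAtTwo W κ),
      toDualR ((PowerSeries.X : IwasawaAlgebra 2) • x) s =
        toDualR x ⟨W.conjH1 2 κ.kerSubgroup γ s, ArchReceptacle.conjH1_mem_relaxedSelmerInftyAtTwo W κ γ s.2⟩ - toDualR x s)
    (hC : ∀ (c : ℤ_[2]) (x : Xr) (s : relaxedSelmerInftyAtTwo W κ) (k : ℕ), (2 ^ k) • s = 0 →
      toDualR (PowerSeries.C c • x) s = (PadicInt.toZModPow k c).val • toDualR x s)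
    (q : Xr →ₗ[IwasawaAlgebra 2] D.X)
    (hq : ∀ (x : Xr) (s : W.selmerInfty κ),
      D.toDual (q x) s = toDualR x (AddSubgroup.inclusion (selmerInfty_le_relaxedSelmerInftyAtTwo W κ) s)) :
    lengthAt (IwasawaAlgebra 2) Xr ⟨augIdealP 2, isPrime_augIdealP_holds 2⟩ =
      lengthAt (IwasawaAlgebra 2) D.X ⟨augIdealP 2, isPrime_augIdealP_holds 2⟩ + 1 := by
  haveI : Module.Finite (IwasawaAlgebra 2) Xr := ArchReceptacle.module_finite_of_pinned W κ hγ toDualR hR hT hC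
  exact le_antisymm (lengthAt_relaxed_le_lengthAt_selmer_add_one W κ toDualR hγ hR hT hC D q hq)
    (ArchRigidity.lengthAt_selmer_add_one_le_lengthAt_relaxed W toDualR h46 hord hΔ hκ hγ D hD hR q hq)

end Summit.BirchSwinnertonDyer.BirchSwinnertonDyer.Theorems.AlignedTransportAtTwoFineRoad.ArchKernelLength

end
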